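import Mathlib
import Summits.QuantumFields.YangMills.Theses.FradkinShenkerFlow
import Summits.QuantumFields.YangMills.Theses.ConvexGribovBody
import Summits.QuantumFields.YangMills.Theses.EquipartitionCriticality

/-!
# Sketch — crux-ideate stmt-QuantumFields-9443 (ClusteringToYangMills), ideator 3, round 1

Checked facts used by the idea cards `dock-continuum-leg` and `slab-coupling-response`.

* `clusteringToYangMills_of_continuumLegGivenGap` : the crux is implied, by pure logic, by the
  existing shared item `ContinuumLegGivenGap` (stmt-QuantumFields-8782, routes ConvexGribovBody and
  SmallCircleAnchor): our hypothesis clusters on ALL tori (`S₁ = 0`), theirs only on `S ≥ S₁(β)`.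
* `UniformiseConstants` + `clusteringToYangMills_dock8762` : docking on the canonical UV leg
  `CriticalContinuumLimit` (stmt-8762) costs exactly one new statement (β-dependent → β-uniform
  clustering constants on large tori); criticality in 8762's form is supplied by the
  EquipartitionCriticality items 8759/8760/8763 without using the crux hypothesis.
* `TiltedCovarianceDerivative` : first lemma of `slab-coupling-response` — the derivative at `t = 0`
  of a covariance under the tilted measure `μ.tilted (t·W)` is the third joint cumulant.
* `SlabResponseIdentity` : its lattice instance — response of a torus Wilson two-point function to
  a LOCAL (test-function-weighted) shift of the coupling = the weighted off-diagonal three-point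
  cumulant of the curvature species.
-/

namespace Summit.QuantumFields.YangMills.Cruxes.ClusteringToYangMills.Ideator3

open MeasureTheory ProbabilityTheory
open Literature.MathematicalPhysics.QuantumFieldTheory Literature.MathematicalPhysics.QuantumLattice

/-- S1 (subsumption): `ContinuumLegGivenGap` (stmt-8782) ⟹ `ClusteringToYangMills` (stmt-9443). -/
theorem clusteringToYangMills_of_continuumLegGivenGap
    (h82 : Summit.QuantumFields.YangMills.Theses.ConvexGribovBody.ContinuumLegGivenGap) :
    Summit.QuantumFields.YangMills.Theses.FradkinShenkerFlow.ClusteringToYangMills := by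
  intro H G _ _ _ _ hG
  refine h82 G hG ?_
  intro r
  letI : MeasurableSpace G := borel G
  haveI : BorelSpace G := ⟨rfl⟩
  obtain ⟨β₀, hβ₀⟩ := H G hG r
  refine ⟨β₀, fun β hβ => ?_⟩
  obtain ⟨m, hm, hAB⟩ := hβ₀ β hβ
  refine ⟨m, hm, 0, fun A B => ?_⟩
  obtain ⟨C, hC⟩ := hAB A B
  exact ⟨C, fun S n _ hn => hC S n hn⟩

/-- D1′ (the one new statement of the 8762-docking line): β-dependent clustering constants on all
tori upgrade to β-UNIFORM constants on tori `S ≥ S₀(β)` for some positive rate function `m(β)`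
(intended proof: OS-norm self-normalisation in infinite volume, `C = ‖A‖∞‖B‖∞` at the true rate,
plus a fixed-β large-torus comparison). -/
def UniformiseConstants : Prop :=
  ∀ (G : Type) [Group G] [TopologicalSpace G] [IsTopologicalGroup G] [CompactSpace G]
    [MeasurableSpace G] [BorelSpace G],
    IsCompactSimpleLieGroup G → ∀ r : LatticeRep G,
      (∃ β₀ : ℝ, ∀ β : ℝ, β₀ ≤ β → ∃ m : ℝ, 0 < m ∧ ∀ A B : YMSpecies G, ∃ C : ℝ, ∀ S n : ℕ,
          n ≤ S → |latticeConnectedCorr r.ρ β (2 * S + 1) A.F B.F n| ≤ C * Real.exp (-(m * n))) →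
      ∃ (β₁ : ℝ) (m : ℝ → ℝ) (S₀ : ℝ → ℕ), (∀ β : ℝ, β₁ ≤ β → 0 < m β) ∧
        ∀ A B : YMSpecies G, ∃ C : ℝ, ∀ β : ℝ, β₁ ≤ β → ∀ S n : ℕ, S₀ β ≤ S → n ≤ S →
          |latticeConnectedCorr r.ρ β (2 * S + 1) A.F B.F n| ≤ C * Real.exp (-(m β * n))

/-- S2 (docking): `UniformiseConstants` + the EquipartitionCriticality items 8759, 8760, 8763, 8762
⟹ `ClusteringToYangMills`. -/
theorem clusteringToYangMills_dock8762 (hU : UniformiseConstants)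
    (h59 : Summit.QuantumFields.YangMills.Theses.EquipartitionCriticality.FreeEnergyLogCoefficient)
    (h60 : Summit.QuantumFields.YangMills.Theses.EquipartitionCriticality.EquipartitionPinsProbe)
    (h63 : Summit.QuantumFields.YangMills.Theses.EquipartitionCriticality.RPProbeCriticality)
    (h62 : Summit.QuantumFields.YangMills.Theses.EquipartitionCriticality.CriticalContinuumLimit) :
    Summit.QuantumFields.YangMills.Theses.FradkinShenkerFlow.ClusteringToYangMills := by
  intro H G _ _ _ _ hG
  refine h62 G hG (fun r => ?_) (fun r => h63 G hG r (h60 G hG r (h59 G hG r)))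
  letI : MeasurableSpace G := borel G
  haveI : BorelSpace G := ⟨rfl⟩
  exact hU G hG r (H G hG r)

/-- First lemma of `slab-coupling-response` (abstract form, provable now): for bounded measurable
`F, G, W` on a probability space, `t ↦ Cov_{μ.tilted (t W)}(F, G)` is differentiable at `0` with
derivative the third joint cumulant `E_μ[(F − EF)(G − EG)(W − EW)]`. -/
def TiltedCovarianceDerivative : Prop :=
  ∀ (Ω : Type) [MeasurableSpace Ω] (μ : Measure Ω) [IsProbabilityMeasure μ] (F G W : Ω → ℝ),
    Measurable F → Measurable G → Measurable W →
    (∃ M : ℝ, ∀ ω, |F ω| ≤ M ∧ |G ω| ≤ M ∧ |W ω| ≤ M) →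
      HasDerivAt (fun t : ℝ => covariance F G (μ.tilted fun ω => t * W ω))
        (∫ ω, (F ω - ∫ x, F x ∂μ) * (G ω - ∫ x, G x ∂μ) * (W ω - ∫ x, W x ∂μ) ∂μ) 0

/-- First lemma of `slab-coupling-response` (lattice instance): on the torus of side `2S+1`, the
response at `t = 0` of the connected two-point function of species `A, B` (B translated by `n e₀`)
under the Wilson measure with LOCALLY shifted coupling `β + t·h(y)` (the shift weighting the
curvature species `r.curvature` translated to `y`) equals the `h`-weighted third cumulant
`Σ_y h(y) κ₃(A, τ_{n e₀}B, τ_y P)`. With `h` supported away from the supports of `A` and `τ_n B`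
this is an OFF-DIAGONAL three-point function of the curvature species — no contact terms. -/
def SlabResponseIdentity : Prop :=
  ∀ (G : Type) [Group G] [TopologicalSpace G] [IsTopologicalGroup G] [CompactSpace G]
    [MeasurableSpace G] [BorelSpace G] (r : LatticeRep G) (β : ℝ) (S n : ℕ)
    (A B : YMSpecies G) (h : Literature.Probability.LatticeModels.Site 4 → ℝ)
    (Y : Finset (Literature.Probability.LatticeModels.Site 4)),
    let μ : Measure (GaugeConfig 4 (2 * S + 1) G) := wilsonMeasure (d := 4) (L := 2 * S + 1) r.ρ β
    let a : GaugeConfig 4 (2 * S + 1) G → ℝ := fun U => A.F (torusLift (2 * S + 1) U)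
    let b : GaugeConfig 4 (2 * S + 1) G → ℝ :=
      fun U => B.F (configShift (-Pi.single 0 (n : ℤ)) (torusLift (2 * S + 1) U))
    let p : Literature.Probability.LatticeModels.Site 4 → GaugeConfig 4 (2 * S + 1) G → ℝ :=
      fun y U => r.curvature.F (configShift (-y) (torusLift (2 * S + 1) U))
    let W : GaugeConfig 4 (2 * S + 1) G → ℝ := fun U => ∑ y ∈ Y, h y * p y U
    HasDerivAt (fun t : ℝ => covariance a b (μ.tilted fun U => t * W U))
      (∑ y ∈ Y, h y * ∫ U, (a U - ∫ V, a V ∂μ) * (b U - ∫ V, b V ∂μ) * (p y U - ∫ V, p y V ∂μ) ∂μ) 0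

end Summit.QuantumFields.YangMills.Cruxes.ClusteringToYangMills.Ideator3
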